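import Summits.ResolutionOfSingularities.ResolutionOfSingularities.Theses.FrobeniusClosing
import Summits.ResolutionOfSingularities.ResolutionOfSingularities.Theorems.FrobeniusClosingPatchingRelPerfectAlgebraizeBlowup
import Summits.ResolutionOfSingularities.ResolutionOfSingularities.Theorems.FrobeniusClosingPatchingRelPerfectLocalDesingNonClosed
import Summits.ResolutionOfSingularities.ResolutionOfSingularities.Theorems.FrobeniusClosingPatchingRelPerfectRoofEngine
import Summits.ResolutionOfSingularities.ResolutionOfSingularities.Theorems.FrobeniusClosingPatchingRelPerfectSliceOfEngine
import Literature.AlgebraicGeometry.Resolution.ResolutionOfComponents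
import HarnessLib

/-!
# Crux `PatchingRelPerfect` (stmt-ResolutionOfSingularities-16161), line `closed-point-slice`:
# the crux CLOSED MODULO its dimension-4 atom, Cossart–Piltant in dimension 3, and the
# dimension-≥5 residual (CONDITIONAL certificate of the line's state)

Route `ResolutionOfSingularities/FrobeniusClosing`, crux #6 (one term shared by eight routes):
`PatchingRelPerfect = ∀ p prime, RelLUPerfect p → ResPerfect p` — relative local uniformization
over PERFECT fields of characteristic `p` ⇒ resolution of every reduced separated scheme of finite
type over every perfect field of characteristic `p`.

With the four TRUE stubs of skeleton v2 of line `closed-point-slice` landed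
(`Theorems.stub_algebraizeBlowup`, `Theorems.stub_localDesingNonClosed`, `Theorems.stub_roofEngine`,
`Theorems.stub_sliceOfEngine`), this file records sorry-free what the line has reduced the crux to:

* `hasResolution_dimLeFour_of_cossartPiltant_of_atom` — **the dimension-`≤ 4` integral slice of
  the crux from the printed Cossart–Piltant 2019 theorems (Thm. 1.1 `CossartPiltant2019General`,
  Prop. 4.4 `CossartPiltant2019Principalization`, named facts of the tree) and the ATOM**
  (`∀ p prime, PunctualCompletePerfect p 4`: for a complete regular local `S` of dimension `≤ 4`,
  `char S = p`, PERFECT residue field, and an integral `T` proper and birational over `Spec S`,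
  regular off the closed fibre, a non-zero ideal sheaf on `T` cosupported in the closed fibre with
  regular blowing up): for every prime `p`, relative LU over perfect fields of characteristic `p`
  gives a resolution of every integral separated finite-type scheme of dimension `≤ 4` over every
  perfect field of characteristic `p`. Composition: LU ⇒ finite resolving system ⇒ join with
  pointwise regular roofs (`stub_sliceOfEngine`) ⇒ Temkin's localization induction
  (`stub_roofEngine`) fed at non-closed bad points by the dimension-3 theorems on a generic fibre
  (`stub_localDesingNonClosed`) and at closed bad points by the atom algebraized
  (`stub_algebraizeBlowup`).
* `patchingRelPerfect_of_cossartPiltant_of_atom_of_dimGeFive` — **the crux BY NAME from the same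
  inputs plus its dimension-`≥ 5` residual** (integral `X` with `¬ dim X ≤ 4`; the parked stub
  `stub_dimGeFive`): reduce resolution over one perfect `k` to integral closed subschemes over the
  same `k` (`hasResolution_of_forall_closeds`) and split on the dimension.

Both are CONDITIONAL results (hypotheses: two named facts, the open atom, the open residual); the
crux item stays open. They are the durable certificate that, for this crux, everything except
"dimension-4 local resolution at perfect closed points over complete regular bases" and
"dimension ≥ 5" is now a theorem of the tree.

## References

* M. Temkin, Adv. Math. 219 (2008), Prop. 2.3.4 and Lemma 2.1.1. [Temkin2008]
* V. Cossart, O. Piltant, J. Algebra 529 (2019), Thm. 1.1 and Prop. 4.4. [CossartPiltant2019]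
* O. Piltant, RACSAM 107 (2013), Prop. 5.1 and Cor. 5.7; p. 2. [Piltant2013]
* O. Zariski, Ann. of Math. 45 (1944), Fundamental Theorem p. 539. [Zariski1944]
-/

-- `Summit.<Summit>.<Sub>.Theorems` with `Sub = Summit` (single-conjunct summit, D-0017)
set_option linter.dupNamespace false

noncomputable section

open CategoryTheory CategoryTheory.Limits AlgebraicGeometry Literature.AlgebraicGeometry.Resolution

namespace Summit.ResolutionOfSingularities.ResolutionOfSingularities.Theorems

/-- **The dimension-`≤ 4` integral slice of `PatchingRelPerfect` from Cossart–Piltant 2019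
(Thm. 1.1, Prop. 4.4) and the dimension-4 ATOM at perfect closed points over complete bases.**
For every prime `p`: relative local uniformization over perfect fields of characteristic `p`
implies that every integral separated scheme of finite type of dimension `≤ 4` over a perfect
field of characteristic `p` has a resolution of singularities — PROVIDED (i) Cossart–Piltant's
printed theorems and (ii) `PunctualCompletePerfect p 4`. A CONDITIONAL result.
[cite: Temkin2008, Prop. 2.3.4; CossartPiltant2019, Thm. 1.1 and Prop. 4.4; Piltant2013, Cor. 5.7] -/
theorem hasResolution_dimLeFour_of_cossartPiltant_of_atom
    (hG : CossartPiltant2019General.{0}) (hP : CossartPiltant2019Principalization.{0})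
    (p : ℕ) (hp : p.Prime)
    (hAtom : ∀ (S : Type) [CommRing S] [IsRegularLocalRing S] [CharP S p]
      [IsAdicComplete (IsLocalRing.maximalIdeal S) S]
      [PerfectField (IsLocalRing.ResidueField S)], ringKrullDim S ≤ (4 : ℕ) →
      ∀ (T : Scheme.{0}) (f : T ⟶ Spec (.of S)), IsIntegral T → IsProper f → IsBirational f →
        (∀ t : T, f.base t ≠ IsLocalRing.closedPoint S → IsRegularLocalRing (T.presheaf.stalk t)) →
        ∃ (J : T.IdealSheafData) (T' : Scheme.{0}) (π : T' ⟶ T), J ≠ ⊥ ∧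
          (∀ t : T, t ∈ J.support → f.base t = IsLocalRing.closedPoint S) ∧
          IsBlowup π J ∧ Scheme.IsRegular T')
    (hLU : ∀ (k K : Type) [Field k] [CharP k p] [PerfectField k] [Field K] [Algebra k K],
      (⊤ : IntermediateField k K).FG → ∀ O : ValuationSubring K, (∀ c : k, algebraMap k K c ∈ O) →
        ∀ R : Subalgebra k K, R.FG → R.toSubring ≤ O.toSubring →
          ∃ (A : Subalgebra k K) (h : A.toSubring ≤ O.toSubring), R ≤ A ∧ A.FG ∧
            IsFractionRing A K ∧ IsRegularLocalRing (Localization.AtPrime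
              (Ideal.comap (Subring.inclusion h) (IsLocalRing.maximalIdeal O))))
    (k : Type) [Field k] [CharP k p] [PerfectField k] (X : Scheme.{0}) (f : X ⟶ Spec (.of k))
    [IsSeparated f] [LocallyOfFiniteType f] [QuasiCompact f] [IsIntegral X]
    (hX : topologicalKrullDim X ≤ 4) : Scheme.HasResolution X :=
  stub_sliceOfEngine p hp hG hP hLU
    (fun k₁ _ _ _ M g _ _ _ _ hdim hroof =>
      stub_roofEngine p hp
        (fun k₂ _ M₂ g₂ _ _ _ _ hdim₂ ζ hζ X' f' J hf' =>
          stub_localDesingNonClosed hG hP k₂ M₂ g₂ hdim₂ ζ hζ X' f' J hf')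
        (fun k₃ _ _ _ S _ _ _ _ hdimS hfin T fT hT hfT hbir hoff =>
          @stub_algebraizeBlowup p hp hAtom k₃ _ _ _ S _ _ _ _ hdimS hfin T fT hT hfT hbir hoff)
        k₁ M g hdim hroof)
    k X f hX

/-- **The crux `FrobeniusClosing.PatchingRelPerfect` BY NAME, from Cossart–Piltant 2019 (Thm. 1.1,
Prop. 4.4), the dimension-4 atom, and the dimension-`≥ 5` residual** (the parked stub
`stub_dimGeFive` of line `closed-point-slice`: the crux restricted to integral `X` with
`¬ dim X ≤ 4`): reduce resolution over one perfect `k` to the integral closed subschemes over the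
same `k` (`hasResolution_of_forall_closeds`) and split on `topologicalKrullDim ≤ 4`. A CONDITIONAL
result — the certificate of what the line has reduced the crux to; the item stays open.
[cite: CossartPiltant2019, Thm. 1.1, Prop. 4.4 and proof of Prop. 4.6, Step 1; Temkin2008, Prop. 2.3.4; Piltant2013, p. 2] -/
theorem patchingRelPerfect_of_cossartPiltant_of_atom_of_dimGeFive
    (hG : CossartPiltant2019General.{0}) (hP : CossartPiltant2019Principalization.{0})
    (hAtom : ∀ (p : ℕ), p.Prime → ∀ (S : Type) [CommRing S] [IsRegularLocalRing S] [CharP S p]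
      [IsAdicComplete (IsLocalRing.maximalIdeal S) S]
      [PerfectField (IsLocalRing.ResidueField S)], ringKrullDim S ≤ (4 : ℕ) →
      ∀ (T : Scheme.{0}) (f : T ⟶ Spec (.of S)), IsIntegral T → IsProper f → IsBirational f →
        (∀ t : T, f.base t ≠ IsLocalRing.closedPoint S → IsRegularLocalRing (T.presheaf.stalk t)) →
        ∃ (J : T.IdealSheafData) (T' : Scheme.{0}) (π : T' ⟶ T), J ≠ ⊥ ∧
          (∀ t : T, t ∈ J.support → f.base t = IsLocalRing.closedPoint S) ∧
          IsBlowup π J ∧ Scheme.IsRegular T')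
    (h5 : ∀ (p : ℕ), p.Prime →
      (∀ (k K : Type) [Field k] [CharP k p] [PerfectField k] [Field K] [Algebra k K],
        (⊤ : IntermediateField k K).FG → ∀ O : ValuationSubring K, (∀ c : k, algebraMap k K c ∈ O) →
          ∀ R : Subalgebra k K, R.FG → R.toSubring ≤ O.toSubring →
            ∃ (A : Subalgebra k K) (h : A.toSubring ≤ O.toSubring), R ≤ A ∧ A.FG ∧
              IsFractionRing A K ∧ IsRegularLocalRing (Localization.AtPrime
                (Ideal.comap (Subring.inclusion h) (IsLocalRing.maximalIdeal O)))) →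
      ∀ (k : Type) [Field k] [CharP k p] [PerfectField k] (X : Scheme.{0}) (f : X ⟶ Spec (.of k)),
        IsSeparated f → LocallyOfFiniteType f → QuasiCompact f → IsIntegral X →
        ¬ topologicalKrullDim X ≤ 4 → Scheme.HasResolution X) :
    Summit.ResolutionOfSingularities.ResolutionOfSingularities.Theses.FrobeniusClosing.PatchingRelPerfect := by
  intro p hp hLU k _ _ _ X f hsep hft hqc hred
  haveI := hft; haveI := hqc; haveI := hred
  refine hasResolution_of_forall_closeds X f fun Z hZ => ?_
  haveI := hZ
  let ι := (Scheme.IdealSheafData.vanishingIdeal Z).subschemeι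
  by_cases hd : topologicalKrullDim ↥(Scheme.IdealSheafData.vanishingIdeal Z).subscheme ≤ 4
  · exact hasResolution_dimLeFour_of_cossartPiltant_of_atom hG hP p hp (hAtom p hp) hLU k _
      (ι ≫ f) hd
  · exact h5 p hp hLU k _ (ι ≫ f) inferInstance inferInstance inferInstance hZ hd

end Summit.ResolutionOfSingularities.ResolutionOfSingularities.Theorems

end
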